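import Summits.CriticalPhenomena.PercolationContinuityZ3.Theorems.PercNearOneGluingNoHeavyLowerTailSahiHalfCoSingletonChains
import Mathlib.Tactic.Linarith
import Mathlib.Tactic.Ring
import HarnessLib

/-!
# `NoHeavyLowerTail` (stmt-CriticalPhenomena-4575) — the half-co-singleton bound on the companion chain family `(f,f,g)`, `f ≤ g`

Support file, seat `prim-l12-p5` (gen 2), `--supports stmt-CriticalPhenomena-4575`; continuation of `…SahiHalfCoSingletonChains`
(split for the 400-line rule).  No definitions, no named facts, no sorries.

**`coSingletonSum_le_two_mul_sahiE_of_le'`**: for `q ∈ [0,1]^ι`, monotone `{0,1}`-valued `f ≤ g` and every coordinate `j`,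
`coSingletonSum q ![f,f,g] j ≤ 2 · E₃(f,f,g)` — HC (P5-REPORT §3h(o),(q)(i)) on the family with two equal SMALL slots.
Proof: `E₃(f,f,g) = a(1−a)(2−b)` (`a = E f`, `b = E g`); the joint-pivotality integrand is `≤ (2−s)·f(hi)(1 − f(lo))` pointwise;
Harris on the co-singleton cube (`sum_hi_mul_one_sub_lo_le` with `h := f`) and the slice bounds give `s(1−s)J ≤ (2−s)a(1−a) ≤ 2(2−b)a(1−a) = 2E₃`.
Together with `coSingletonSum_le_two_mul_sahiE_of_le` ((h,h,f), `f ≤ h`, the family where the constant `2` is sharp) this settles HC on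
both two-equal-slot chain families.
-/

namespace Summit.CriticalPhenomena.PercolationContinuityZ3.Theorems

namespace SahiCoSingleton

open Finset Literature.Combinatorics.Sahi2008 SahiSubsetChord

variable {ι : Type*} [Fintype ι] [DecidableEq ι]

/-- **HC on the family `(f,f,g)` with `f ≤ g`** (two equal SMALL slots and a larger third): for every coordinate `j`,
`E[E₃ of the one-coin sections of (f,f,g) at j] ≤ 2·E₃(f,f,g)`.  Proof: `E₃(f,f,g) = a(1−a)(2−b)` (`a = E f`, `b = E g`); the
`J`-integrand is `≤ (2−s)·f(hi)(1−f(lo))` pointwise; Harris and the slice bounds give `s(1−s)·J ≤ (2−s)·a(1−a) ≤ 2(2−b)a(1−a)`.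
[this file] -/
theorem coSingletonSum_le_two_mul_sahiE_of_le' (q : ι → ℝ) (hq : ∀ i, 0 ≤ q i ∧ q i ≤ 1) (f g : (ι → Bool) → ℝ)
    (hf01 : ∀ x, f x = 0 ∨ f x = 1) (hg01 : ∀ x, g x = 0 ∨ g x = 1) (hfm : Monotone f) (hgm : Monotone g)
    (hfg : ∀ x, f x ≤ g x) (j : ι) :
    coSingletonSum q ![f, f, g] j ≤ 2 * sahiE (prodWeight q) 3 ![f, f, g] := by
  have hind : ∀ a x, (![f, f, g] : Fin 3 → (ι → Bool) → ℝ) a x = 0 ∨ (![f, f, g] : Fin 3 → (ι → Bool) → ℝ) a x = 1 := by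
    intro a x; fin_cases a
    · exact hf01 x
    · exact hf01 x
    · exact hg01 x
  have hmono : ∀ a, Monotone ((![f, f, g] : Fin 3 → (ι → Bool) → ℝ) a) := by
    intro a; fin_cases a
    · exact hfm
    · exact hfm
    · exact hgm
  have hf0 : ∀ x, 0 ≤ f x := fun x => by rcases hf01 x with e | e <;> simp [e]
  have hf1 : ∀ x, f x ≤ 1 := fun x => by rcases hf01 x with e | e <;> simp [e]
  have hg1 : ∀ x, g x ≤ 1 := fun x => by rcases hg01 x with e | e <;> simp [e]
  set s := q j with hs
  have hs0 : 0 ≤ s := (hq j).1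
  have hs1 : s ≤ 1 := (hq j).2
  set w : ({i // i ∈ (univ : Finset ι).erase j} → Bool) → ℝ :=
    prodWeight (fun i : {i // i ∈ (univ : Finset ι).erase j} => q i) with hw
  have hw0 : ∀ v, 0 ≤ w v := fun v =>
    prodWeight_nonneg (q := fun i : {i // i ∈ (univ : Finset ι).erase j} => q i) (fun i => hq i) v
  -- (1) E₃(f,f,g) = 2a + a²b − 2a² − ab  (= a(1−a)(2−b)) with a = E f, b = E g
  set a := ex (prodWeight q) f with ha
  set b := ex (prodWeight q) g with hb
  have hffg : f * f * g = f := by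
    funext x; simp only [Pi.mul_apply]
    rcases hf01 x with e | e
    · rw [e]; ring
    · have : g x = 1 := le_antisymm (hg1 x) (by rw [← e]; exact hfg x)
      rw [e, this]; ring
  have hfg' : f * g = f := by
    funext x; simp only [Pi.mul_apply]
    rcases hf01 x with e | e
    · rw [e]; ring
    · have : g x = 1 := le_antisymm (hg1 x) (by rw [← e]; exact hfg x)
      rw [e, this]; ring
  have hff : f * f = f := by
    funext x; simp only [Pi.mul_apply]
    rcases hf01 x with e | e <;> rw [e] <;> ring
  have hE3 : sahiE (prodWeight q) 3 ![f, f, g] = 2 * a + a ^ 2 * b - 2 * a ^ 2 - a * b := by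
    rw [sahiE_three_apply]
    simp only [Matrix.cons_val_zero, Matrix.cons_val_one, Matrix.head_cons, Matrix.cons_val_two, Matrix.tail_cons,
      hfg', hff]
    ring
  have ha0 : 0 ≤ a := ex_nonneg (fun x => prodWeight_nonneg hq x) hf0
  have hsum : ∑ x, prodWeight q x = 1 := sum_coinWeight q
  have ha1 : a ≤ 1 := by
    have := ex_mono (μ := prodWeight q) (fun x => prodWeight_nonneg hq x) hf1
    rwa [ex_const hsum] at this
  have hb1 : b ≤ 1 := by
    have := ex_mono (μ := prodWeight q) (fun x => prodWeight_nonneg hq x) hg1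
    rwa [ex_const hsum] at this
  -- (2) Z = s(1−s)·J and the pointwise bound J-integrand ≤ (2−s)·f(hi)(1−f(lo))
  rw [coSingletonSum_eq q _ hind hmono j]
  have hJ : jointPivotality q ![f, f, g] j ≤ (2 - s) * ∑ v, w v * (f (hi j v) * (1 - f (lo j v))) := by
    unfold jointPivotality
    rw [Finset.mul_sum]
    refine Finset.sum_le_sum fun v _ => ?_
    simp only [Matrix.cons_val_zero, Matrix.cons_val_one, Matrix.head_cons, Matrix.cons_val_two, Matrix.tail_cons]
    have hw0v := hw0 v
    have hlohi : lo j v ≤ hi j v := by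
      intro i; unfold lo hi glue; split_ifs
      · exact le_rfl
      · exact Bool.false_le _
    have m_f : f (lo j v) ≤ f (hi j v) := hfm hlohi
    have m_g : g (lo j v) ≤ g (hi j v) := hgm hlohi
    have c_lo : f (lo j v) ≤ g (lo j v) := hfg _
    have c_hi : f (hi j v) ≤ g (hi j v) := hfg _
    have h2s : 0 ≤ 2 - s := by linarith
    rcases hf01 (lo j v) with f0 | f0 <;> rcases hf01 (hi j v) with f1 | f1 <;>
      rcases hg01 (lo j v) with g0 | g0 <;> rcases hg01 (hi j v) with g1 | g1 <;>
      simp only [f0, f1, g0, g1] at m_f m_g c_lo c_hi ⊢ <;>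
      nlinarith [hw0v, h2s, hs1]
  -- (3) Harris with h := f, (4) slices
  have hH := sum_hi_mul_one_sub_lo_le q hq f f hf0 hf0 hfm hfm j
  have hA : s * ∑ v, w v * f (hi j v) ≤ a := mul_sum_hi_le_ex q hq f hf0 j
  have hB : (1 - s) * ∑ v, w v * (1 - f (lo j v)) ≤ 1 - a := by
    have := mul_sum_lo_le_ex q hq (fun x => 1 - f x) (fun x => by linarith [hf1 x]) j
    have e : ex (prodWeight q) (fun x => 1 - f x) = 1 - a := by
      unfold ex
      rw [show (1 : ℝ) - a = ∑ x, prodWeight q x - ∑ x, prodWeight q x * f x by rw [hsum]; rfl,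
        ← Finset.sum_sub_distrib]
      refine Finset.sum_congr rfl fun x _ => ?_; ring
    rw [e] at this; exact this
  have hY0 : 0 ≤ ∑ v, w v * (1 - f (lo j v)) :=
    Finset.sum_nonneg fun v _ => mul_nonneg (hw0 v) (by linarith [hf1 (lo j v)])
  have hJ0 : 0 ≤ ∑ v, w v * (f (hi j v) * (1 - f (lo j v))) :=
    Finset.sum_nonneg fun v _ => mul_nonneg (hw0 v) (mul_nonneg (hf0 _) (by linarith [hf1 (lo j v)]))
  -- (5) assemble
  rw [hE3]
  have hss : 0 ≤ s * (1 - s) := mul_nonneg hs0 (by linarith)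
  have h2s : 0 ≤ 2 - s := by linarith
  have step1 : s * (1 - s) * jointPivotality q ![f, f, g] j
      ≤ s * (1 - s) * ((2 - s) * ∑ v, w v * (f (hi j v) * (1 - f (lo j v)))) :=
    mul_le_mul_of_nonneg_left hJ hss
  have step2 : s * (1 - s) * ((2 - s) * ∑ v, w v * (f (hi j v) * (1 - f (lo j v))))
      ≤ (2 - s) * ((s * ∑ v, w v * f (hi j v)) * ((1 - s) * ∑ v, w v * (1 - f (lo j v)))) := by
    have := mul_le_mul_of_nonneg_left hH hss
    nlinarith [this, h2s, hss, hJ0]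
  have step3 : (s * ∑ v, w v * f (hi j v)) * ((1 - s) * ∑ v, w v * (1 - f (lo j v))) ≤ a * (1 - a) :=
    mul_le_mul hA hB (mul_nonneg (by linarith) hY0) ha0
  have ha1' : 0 ≤ 1 - a := by linarith
  have step4 : (2 - s) * (a * (1 - a)) ≤ 2 * (2 * a + a ^ 2 * b - 2 * a ^ 2 - a * b) := by
    have e : 2 * (2 * a + a ^ 2 * b - 2 * a ^ 2 - a * b) = (2 * (2 - b)) * (a * (1 - a)) := by ring
    rw [e]
    exact mul_le_mul_of_nonneg_right (by linarith) (mul_nonneg ha0 ha1')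
  calc s * (1 - s) * jointPivotality q ![f, f, g] j
      ≤ s * (1 - s) * ((2 - s) * ∑ v, w v * (f (hi j v) * (1 - f (lo j v)))) := step1
    _ ≤ (2 - s) * ((s * ∑ v, w v * f (hi j v)) * ((1 - s) * ∑ v, w v * (1 - f (lo j v)))) := step2
    _ ≤ (2 - s) * (a * (1 - a)) := mul_le_mul_of_nonneg_left step3 h2s
    _ ≤ 2 * (2 * a + a ^ 2 * b - 2 * a ^ 2 - a * b) := step4

end SahiCoSingleton

end Summit.CriticalPhenomena.PercolationContinuityZ3.Theorems
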